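import Literature.Topology.FourManifolds.IndefiniteCuspModel
import Literature.Topology.FourManifolds.RegularLevelSet
import Literature.Analysis.Calculus.HadamardDivisionLast
import HarnessLib

/-!
# Fold charts for suspended families: the parametric Morse lemma in one variable

Topic `Literature/Topology/FourManifolds`.  A critical point of a map from a 4-manifold to a
surface is an *indefinite fold point* if in suitable smooth charts the map is
`(t, x₁, x₂, x₃) ↦ (t, x₁² + x₂² - x₃²)` — the clause `fold` of
`IsSimplifiedBrokenLefschetzFibration` (Hayano 2011, Def. 2.1 (4); Baykur–Saeki 2017, §2.1,
p. 6: *"a fold singularity if the map is locally given by `(t, x₁, x₂, x₃) ↦ (t, ±x₁² ± x₂² ±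
x₃²)` … indefinite otherwise"*).  The files `WrinkledFibrationMoveModels.lean`,
`IndefiniteCuspModel.lean`, … compute the critical SETS of the rank-one local models
`F = (t, g(t, x) + y² - z²)` (`suspendedMap g`) of the move calculus; this file PROVES that their
critical points with `∂ₓ∂ₓ g ≠ 0` really are indefinite fold points in the above chart sense —
the bridge between those computations and the definition of a broken Lefschetz fibration.  The
proof is the classical parametric Morse lemma in one variable, assembled from the tree's
inverse function theorem (`Literature.Topology.FourManifolds.exists_openPartialHomeomorph_contDiffOn_symm`) and
Hadamard division with parameters (`Literature.Analysis.Calculus.exists_local_lastQuot`).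
No named fact is introduced.

* `HasIndefiniteFoldChart F x` — the chart condition of the `fold` clause, for a map
  `F : ℝ⁴ → ℝ²` at a point `x` (a DEFINITION with body);
* `exists_critCurve_suspended` — near a critical point with `∂ₓ∂ₓ g ≠ 0` the critical set
  `{∂ₓ g = 0}` is a smooth graph `x = ξ(t)` (inverse function theorem);
* `exists_sq_mul_suspended`, `two_mul_eq_of_sq_mul` — `g(t, ξ t + u) = g(t, ξ t) + u² Q(t, u)`
  with `Q` smooth and `2 Q(t₀, 0) = ∂ₓ∂ₓ g(t₀, x₀)` (Hadamard division twice);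
* `exists_foldChart_suspendedMap`, `hasIndefiniteFoldChart_suspendedMap` — **every critical
  point of a suspended family with `∂ₓ∂ₓ g ≠ 0` is an indefinite fold point**;
* `hasIndefiniteFoldChart_indefiniteCuspMap` (*"an indefinite cusp is always adjacent to
  indefinite fold arcs"*, Baykur–Saeki p. 6: every critical point of the cusp model except the
  cusp is a fold point), `hasIndefiniteFoldChart_birthMap`, `hasIndefiniteFoldChart_mergeMap`
  (`x ≠ 0` on the critical set), `hasIndefiniteFoldChart_flipMap` (`6x² ≠ s`; the excluded
  points are exactly the cusps of `SuspendedFamilyCriticalImage.lean`).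

## References

* R. İ. Baykur, O. Saeki, *Simplifying indefinite fibrations on 4-manifolds*, arXiv:1705.11169
  (Trans. AMS 376, 2023), §2.1. [BaykurSaeki2017]
* K. Hayano, *On genus-1 simplified broken Lefschetz fibrations*, Algebr. Geom. Topol. 11
  (2011), Def. 2.1. [Hayano2011]
* Y. Lekili, *Wrinkled fibrations on near-symplectic manifolds*, Geom. Topol. 13 (2009), §3.
  [Lekili2009]
-/

noncomputable section

open Set Function Filter
open scoped Topology ContDiff

namespace Literature.Topology.FourManifolds

/-- Local notation: `𝔼 n` is the model Euclidean space `EuclideanSpace ℝ (Fin n)`. -/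
local notation "𝔼 " n:arg => EuclideanSpace ℝ (Fin n)

/-! ### A linear shear of the plane -/

/-- The linear shear `(s, y) ↦ (s, a s + b y)` of `ℝ²`, `b ≠ 0`, as a continuous linear
equivalence (inverse `(s, y) ↦ (s, (y - a s)/b)`): the shape of the derivative of
`(t, x) ↦ (t, h(t, x))` when `∂ₓ h ≠ 0`. [folklore] -/
def planeShearEquiv (a b : ℝ) (hb : b ≠ 0) : (ℝ × ℝ) ≃L[ℝ] (ℝ × ℝ) :=
  ContinuousLinearEquiv.equivOfInverse
    ((ContinuousLinearMap.fst ℝ ℝ ℝ).prod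
      (a • ContinuousLinearMap.fst ℝ ℝ ℝ + b • ContinuousLinearMap.snd ℝ ℝ ℝ))
    ((ContinuousLinearMap.fst ℝ ℝ ℝ).prod
      (b⁻¹ • (ContinuousLinearMap.snd ℝ ℝ ℝ - a • ContinuousLinearMap.fst ℝ ℝ ℝ)))
    (by
      intro p
      ext
      · simp
      · simp
        field_simp)
    (by
      intro p
      ext
      · simp
      · simp
        field_simp
        ring)

/-- The shear acts by `(s, y) ↦ (s, a s + b y)`. [folklore] -/
@[simp] theorem planeShearEquiv_apply (a b : ℝ) (hb : b ≠ 0) (p : ℝ × ℝ) :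
    planeShearEquiv a b hb p = (p.1, a * p.1 + b * p.2) := by
  simp [planeShearEquiv]

/-! ### Step A: near a fold point the critical set of a suspended family is a graph over `t` -/

/-- **The critical curve of a suspended family near a point with `∂ₓg = 0 ≠ ∂ₓₓg`.**  Let
`g : ℝ² → ℝ` be `C^∞` with derivative `g'`, and let `(t₀, x₀)` satisfy `∂ₓ g (t₀, x₀) = 0` and
`∂ₓ∂ₓ g (t₀, x₀) ≠ 0` (the derivative `g''` of `∂ₓ g = g'(·)(0, 1)` at `(t₀, x₀)` has
`g''(0, 1) ≠ 0`).  Then on an open interval `U ∋ t₀` there is a `C^∞` function `ξ` with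
`ξ t₀ = x₀` and `∂ₓ g (t, ξ t) = 0`: the critical set `{∂ₓ g = 0, y = z = 0}` of the suspended
family `(t, g(t, x) + y² - z²)` (`surjective_fderiv_suspendedMap_iff`) is, near `(t₀, x₀, 0, 0)`,
the graph of `ξ` over the `t`-axis.  Proof: `(t, x) ↦ (t, ∂ₓ g(t, x))` is a local
diffeomorphism at `(t₀, x₀)` (inverse function theorem; its derivative is the shear
`planeShearEquiv (g''(1,0)) (g''(0,1))`), and `ξ t` is the second coordinate of the preimage of
`(t, 0)`. [folklore] -/
theorem exists_critCurve_suspended {g : ℝ × ℝ → ℝ} (hg : ContDiff ℝ ∞ g)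
    {g' : ℝ × ℝ → ℝ × ℝ →L[ℝ] ℝ} (hg' : ∀ p, HasFDerivAt g (g' p) p) {t₀ x₀ : ℝ}
    {g'' : ℝ × ℝ →L[ℝ] ℝ} (hg'' : HasFDerivAt (fun p => g' p (0, 1)) g'' (t₀, x₀))
    (hcrit : g' (t₀, x₀) (0, 1) = 0) (hfold : g'' (0, 1) ≠ 0) :
    ∃ U : Set ℝ, IsOpen U ∧ t₀ ∈ U ∧ ∃ ξ : ℝ → ℝ, ContDiffOn ℝ ∞ ξ U ∧ ξ t₀ = x₀ ∧
      ∀ t ∈ U, g' (t, ξ t) (0, 1) = 0 := by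
  -- `∂ₓ g` is smooth
  set gx : ℝ × ℝ → ℝ := fun p => g' p (0, 1) with hgx_def
  have hfd : fderiv ℝ g = g' := funext fun p => (hg' p).fderiv
  have hgx : ContDiff ℝ ∞ gx := by
    have h1 : ContDiff ℝ ∞ (fderiv ℝ g) := hg.fderiv_right le_rfl
    rw [hfd] at h1
    exact h1.clm_apply contDiff_const
  -- the map `Θ (t, x) = (t, ∂ₓ g (t, x))` and its derivative at `(t₀, x₀)`
  set Θ : ℝ × ℝ → ℝ × ℝ := fun p => (p.1, gx p) with hΘ_def
  have hΘs : ContDiff ℝ ∞ Θ := contDiff_fst.prodMk hgx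
  have hΘd : HasFDerivAt Θ
      ((planeShearEquiv (g'' (1, 0)) (g'' (0, 1)) hfold : (ℝ × ℝ) ≃L[ℝ] ℝ × ℝ) : ℝ × ℝ →L[ℝ] ℝ × ℝ)
      (t₀, x₀) := by
    have h := (hasFDerivAt_fst (𝕜 := ℝ) (p := (t₀, x₀)) (F := ℝ)).prodMk hg''
    refine h.congr_fderiv (ContinuousLinearMap.ext fun v => ?_)
    obtain ⟨v₁, v₂⟩ := v
    rw [ContinuousLinearEquiv.coe_coe, planeShearEquiv_apply]
    refine Prod.ext (by simp) ?_
    simp only [ContinuousLinearMap.prod_apply]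
    rw [OneParamTransversality.apply_prod_eq g'' v₁ v₂]
    ring
  obtain ⟨G₁, hG₁Θ, hmem, -, -, hG₁s'⟩ :=
    exists_openPartialHomeomorph_contDiffOn_symm isOpen_univ (mem_univ (t₀, x₀)) (m := ∞)
      (by simp) hΘs.contDiffOn _ hΘd
  -- the interval `U` and the function `ξ`
  have hΘ₀ : G₁ (t₀, x₀) = (t₀, 0) := by
    rw [hG₁Θ]
    simp [hΘ_def, hgx_def, hcrit]
  have htarget : ((t₀, (0 : ℝ)) : ℝ × ℝ) ∈ G₁.target := hΘ₀ ▸ G₁.map_source hmem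
  refine ⟨{t | ((t, (0 : ℝ)) : ℝ × ℝ) ∈ G₁.target},
    G₁.open_target.preimage (continuous_id.prodMk continuous_const), htarget,
    fun t => (G₁.symm (t, 0)).2, ?_, ?_, ?_⟩
  · have hc : ContDiffOn ℝ ∞ (fun t : ℝ => ((t, (0 : ℝ)) : ℝ × ℝ))
        {t | ((t, (0 : ℝ)) : ℝ × ℝ) ∈ G₁.target} :=
      (contDiff_id.prodMk contDiff_const).contDiffOn
    exact (hG₁s'.comp hc fun t ht => ht).snd
  · show (G₁.symm (t₀, 0)).2 = x₀
    rw [← hΘ₀, G₁.left_inv hmem]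
  · intro t ht
    have h1 : G₁ (G₁.symm (t, 0)) = (t, 0) := G₁.right_inv ht
    rw [hG₁Θ] at h1
    have h1a : (G₁.symm (t, 0)).1 = t := congrArg Prod.fst h1
    have h1b : gx (G₁.symm (t, 0)) = 0 := congrArg Prod.snd h1
    show gx (t, (G₁.symm (t, 0)).2) = 0
    rw [show ((t, (G₁.symm (t, 0)).2) : ℝ × ℝ) = G₁.symm (t, 0) from Prod.ext h1a.symm rfl]
    exact h1b

/-! ### Step B: Hadamard division twice — `g(t, ξ t + u) - g(t, ξ t) = u² Q(t, u)` -/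

/-- **Parametric Hadamard division at a family of critical points.**  If `ξ` is `C^∞` on the
open set `U ∋ t₀` and `∂ₓ g (t, ξ t) = 0` for `t ∈ U`, then there is a globally `C^∞` function
`Q` with `g(t, ξ t + u) - g(t, ξ t) = u² Q(t, u)` for all `t` near `t₀` and all `u`
(`Literature.Analysis.Calculus.exists_local_lastQuot`, applied twice: the first quotient
vanishes at `u = 0` because its value there is `∂ₓ g (t, ξ t) = 0`). [folklore] -/
theorem exists_sq_mul_suspended {g : ℝ × ℝ → ℝ} (hg : ContDiff ℝ ∞ g)
    {g' : ℝ × ℝ → ℝ × ℝ →L[ℝ] ℝ} (hg' : ∀ p, HasFDerivAt g (g' p) p)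
    {U : Set ℝ} (hU : IsOpen U) {t₀ : ℝ} (ht₀ : t₀ ∈ U) {ξ : ℝ → ℝ} (hξ : ContDiffOn ℝ ∞ ξ U)
    (hcrit : ∀ t ∈ U, g' (t, ξ t) (0, 1) = 0) :
    ∃ Q : ℝ × ℝ → ℝ, ContDiff ℝ ∞ Q ∧
      ∀ᶠ t in 𝓝 t₀, ∀ u, g (t, ξ t + u) - g (t, ξ t) = u ^ 2 * Q (t, u) := by
  set G : ℝ × ℝ → ℝ := fun p => g (p.1, ξ p.1 + p.2) - g (p.1, ξ p.1) with hG_def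
  have hξ' : ContDiffOn ℝ ∞ (fun p : ℝ × ℝ => ξ p.1) (U ×ˢ univ) :=
    hξ.comp contDiffOn_fst fun p hp => hp.1
  have hGs : ContDiffOn ℝ ∞ G (U ×ˢ univ) :=
    (hg.comp_contDiffOn (contDiffOn_fst.prodMk (hξ'.add contDiffOn_snd))).sub
      (hg.comp_contDiffOn (contDiffOn_fst.prodMk hξ'))
  have hG0 : ∀ t ∈ U, G (t, 0) = 0 := fun t _ => by simp [hG_def]
  obtain ⟨Q₁, hQ₁s, hQ₁, hQ₁0⟩ := Literature.Analysis.Calculus.exists_local_lastQuot hU hGs hG0 ht₀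
  -- the `u`-derivative of `G` at `u = 0` is `∂ₓ g (t, ξ t) = 0`
  have hdG : ∀ t ∈ U, fderiv ℝ G (t, 0) ((0 : ℝ), (1 : ℝ)) = 0 := by
    intro t ht
    have hGd : DifferentiableAt ℝ G (t, 0) :=
      (hGs.contDiffAt ((hU.prod isOpen_univ).mem_nhds ⟨ht, mem_univ _⟩)).differentiableAt
        (by simp)
    have hline : HasDerivAt (fun u : ℝ => ((t, u) : ℝ × ℝ)) ((0 : ℝ), (1 : ℝ)) 0 := by
      simpa using (hasDerivAt_const (0 : ℝ) t).prodMk (hasDerivAt_id (0 : ℝ))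
    have h1 : HasDerivAt (fun u : ℝ => G (t, u)) (fderiv ℝ G (t, 0) ((0 : ℝ), (1 : ℝ))) 0 :=
      hGd.hasFDerivAt.comp_hasDerivAt (0 : ℝ) hline
    have hline2 : HasDerivAt (fun u : ℝ => ((t, ξ t + u) : ℝ × ℝ)) ((0 : ℝ), (1 : ℝ)) 0 := by
      simpa using (hasDerivAt_const (0 : ℝ) t).prodMk ((hasDerivAt_id (0 : ℝ)).const_add (ξ t))
    have h2 : HasDerivAt (fun u : ℝ => G (t, u)) (g' (t, ξ t + 0) ((0 : ℝ), (1 : ℝ))) 0 := by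
      have h := ((hg' (t, ξ t + 0)).comp_hasDerivAt (0 : ℝ) hline2).sub_const (g (t, ξ t))
      simpa [hG_def] using h
    rw [h1.unique h2, add_zero]
    exact hcrit t ht
  -- shrink to an open `U₁ ∋ t₀` on which `Q₁ (t, 0) = 0`, and divide again
  obtain ⟨U₁, hU₁sub, hU₁o, ht₀U₁⟩ : ∃ U₁ ⊆ {t | t ∈ U ∧
      Q₁ (t, 0) = fderiv ℝ G (t, 0) ((0 : ℝ), (1 : ℝ))}, IsOpen U₁ ∧ t₀ ∈ U₁ :=
    _root_.mem_nhds_iff.1 (Filter.inter_mem (hU.mem_nhds ht₀) hQ₁0)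
  have hQ₁z : ∀ t ∈ U₁, Q₁ (t, 0) = 0 := fun t ht => by
    obtain ⟨htU, hq⟩ := hU₁sub ht
    rw [hq, hdG t htU]
  obtain ⟨Q₂, hQ₂s, hQ₂, -⟩ :=
    Literature.Analysis.Calculus.exists_local_lastQuot hU₁o hQ₁s.contDiffOn hQ₁z ht₀U₁
  refine ⟨Q₂, hQ₂s, ?_⟩
  filter_upwards [hQ₁, hQ₂] with t h1 h2 u
  have h := h1 u
  simp only [hG_def, smul_eq_mul] at h
  rw [h, h2 u, smul_eq_mul]
  ring

/-- **The quotient at the base point is half the second derivative**: if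
`g(t₀, x₀ + u) - g(t₀, x₀) = u² Q(t₀, u)` for all `u` then `2 Q(t₀, 0) = ∂ₓ∂ₓ g (t₀, x₀)`
(differentiate twice at `u = 0`). [folklore] -/
theorem two_mul_eq_of_sq_mul {g : ℝ × ℝ → ℝ} {g' : ℝ × ℝ → ℝ × ℝ →L[ℝ] ℝ}
    (hg' : ∀ p, HasFDerivAt g (g' p) p) {t₀ x₀ : ℝ} {g'' : ℝ × ℝ →L[ℝ] ℝ}
    (hg'' : HasFDerivAt (fun p => g' p (0, 1)) g'' (t₀, x₀)) {Q : ℝ × ℝ → ℝ}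
    (hQ : ContDiff ℝ ∞ Q) (h : ∀ u, g (t₀, x₀ + u) - g (t₀, x₀) = u ^ 2 * Q (t₀, u)) :
    2 * Q (t₀, 0) = g'' (0, 1) := by
  -- derivatives of `φ u = g (t₀, x₀ + u) - g (t₀, x₀)`
  have hφ' : ∀ u, HasDerivAt (fun u => g (t₀, x₀ + u) - g (t₀, x₀))
      (g' (t₀, x₀ + u) ((0 : ℝ), (1 : ℝ))) u := by
    intro u
    have hline : HasDerivAt (fun u : ℝ => ((t₀, x₀ + u) : ℝ × ℝ)) ((0 : ℝ), (1 : ℝ)) u := by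
      simpa using (hasDerivAt_const u t₀).prodMk ((hasDerivAt_id u).const_add x₀)
    exact ((hg' (t₀, x₀ + u)).comp_hasDerivAt u hline).sub_const _
  have hφ'' : HasDerivAt (fun u => g' (t₀, x₀ + u) ((0 : ℝ), (1 : ℝ))) (g'' ((0 : ℝ), (1 : ℝ)))
      0 := by
    have hline : HasDerivAt (fun u : ℝ => ((t₀, x₀ + u) : ℝ × ℝ)) ((0 : ℝ), (1 : ℝ)) 0 := by
      simpa using (hasDerivAt_const (0 : ℝ) t₀).prodMk ((hasDerivAt_id (0 : ℝ)).const_add x₀)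
    exact hg''.comp_hasDerivAt_of_eq (0 : ℝ) hline (by simp)
  -- derivatives of `ψ u = u² q u`, `q u = Q (t₀, u)`
  set q : ℝ → ℝ := fun u => Q (t₀, u) with hq_def
  have hq : ContDiff ℝ ∞ q := hQ.comp (contDiff_const.prodMk contDiff_id)
  have hqd : ∀ u, HasDerivAt q (deriv q u) u := fun u =>
    ((hq.differentiable (by simp)) u).hasDerivAt
  have hq'c : ContDiff ℝ ∞ (deriv q) := hq.iterate_deriv 1
  have hψ' : ∀ u, HasDerivAt (fun u => u ^ 2 * q u) (2 * u * q u + u ^ 2 * deriv q u) u := by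
    intro u
    refine ((hasDerivAt_pow 2 u).mul (hqd u)).congr_deriv ?_
    simp
  have hψ'' : HasDerivAt (fun u => 2 * u * q u + u ^ 2 * deriv q u) (2 * q 0) 0 := by
    have h1 : HasDerivAt (fun u => 2 * u * q u) (2 * q 0) 0 := by
      refine (((hasDerivAt_id (0 : ℝ)).const_mul 2).mul (hqd 0)).congr_deriv ?_
      simp
    have h2 : HasDerivAt (fun u => u ^ 2 * deriv q u) 0 0 := by
      refine ((hasDerivAt_pow 2 (0 : ℝ)).mul
        (((hq'c.differentiable (by simp)) 0).hasDerivAt)).congr_deriv ?_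
      simp
    simpa using h1.fun_add h2
  -- `φ = ψ`, hence `φ' = ψ'`, hence `φ''(0) = ψ''(0)`
  have hfun : (fun u => g (t₀, x₀ + u) - g (t₀, x₀)) = fun u => u ^ 2 * q u := funext h
  have hder : (fun u => g' (t₀, x₀ + u) ((0 : ℝ), (1 : ℝ))) =
      fun u => 2 * u * q u + u ^ 2 * deriv q u := by
    have e1 : deriv (fun u => g (t₀, x₀ + u) - g (t₀, x₀)) =
        fun u => g' (t₀, x₀ + u) ((0 : ℝ), (1 : ℝ)) := funext fun u => (hφ' u).deriv
    have e2 : deriv (fun u => u ^ 2 * q u) = fun u => 2 * u * q u + u ^ 2 * deriv q u :=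
      funext fun u => (hψ' u).deriv
    rw [← e1, ← e2, hfun]
  rw [hder] at hφ''
  exact hψ''.unique hφ''


/-! ### A linear-algebra helper: injective endomorphisms of finite-dimensional spaces -/

/-- An injective continuous linear endomorphism of a finite-dimensional space is (the coercion
of) a continuous linear equivalence. [folklore] -/
theorem exists_continuousLinearEquiv_coe_eq {E : Type*} [NormedAddCommGroup E]
    [NormedSpace ℝ E] [FiniteDimensional ℝ E] {Φ' : E →L[ℝ] E} (h : Injective Φ') :
    ∃ T : E ≃L[ℝ] E, (T : E →L[ℝ] E) = Φ' :=
  ⟨(LinearEquiv.ofInjectiveEndo Φ'.toLinearMap h).toContinuousLinearEquiv, by ext v; rfl⟩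

/-! ### The chart condition of an indefinite fold point -/

/-- **Indefinite fold chart at `x` for a map `F : ℝ⁴ → ℝ²`**: local diffeomorphisms `φ` of `ℝ⁴`
at `x` (`φ x = 0`) and `ψ` of `ℝ²` near `F x`, `C^∞` with `C^∞` inverses on their sources and
targets, with `ψ (F q) = ((φ q)₀, (φ q)₁² + (φ q)₂² - (φ q)₃²)` for `q` in the source of `φ` —
literally the condition of the clause `IsSimplifiedBrokenLefschetzFibration.fold` (Hayano 2011,
Def. 2.1 (4); Baykur–Saeki 2017, §2.1), written for maps between the model spaces.
[cite: BaykurSaeki2017, §2.1] -/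
def HasIndefiniteFoldChart (F : 𝔼 4 → 𝔼 2) (x : 𝔼 4) : Prop :=
  ∃ (φ : OpenPartialHomeomorph (𝔼 4) (𝔼 4)) (ψ : OpenPartialHomeomorph (𝔼 2) (𝔼 2)),
    x ∈ φ.source ∧ φ x = 0 ∧ MapsTo F φ.source ψ.source ∧
    ContDiffOn ℝ ∞ φ φ.source ∧ ContDiffOn ℝ ∞ φ.symm φ.target ∧
    ContDiffOn ℝ ∞ ψ ψ.source ∧ ContDiffOn ℝ ∞ ψ.symm ψ.target ∧
    ∀ q ∈ φ.source, ψ (F q) 0 = φ q 0 ∧ ψ (F q) 1 = φ q 1 ^ 2 + φ q 2 ^ 2 - φ q 3 ^ 2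

/-! ### Steps C–D: the fold chart -/

/-- **Fold chart for a suspended family (parametric Morse lemma).**  Let
`F = (t, g(t, x) + y² - z²)` be the suspended family of a `C^∞` function `g` (derivative `g'`),
and let `x` be a critical point of `F` (so `x₂ = x₃ = 0` and `∂ₓ g (x₀, x₁) = 0`,
`surjective_fderiv_suspendedMap_iff`) at which `∂ₓ∂ₓ g (x₀, x₁) ≠ 0`.  Then `x` is an
INDEFINITE FOLD point of `F` in the sense of the definition of a (simplified) broken Lefschetz
fibration (`IsSimplifiedBrokenLefschetzFibration.fold`): there are local diffeomorphisms `φ` of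
`ℝ⁴` at `x` with `φ x = 0` and `ψ` of `ℝ²` at `F x` with
`ψ ∘ F = (φ₀, φ₁² + φ₂² - φ₃²)` on the source of `φ`.
Proof (Baykur–Saeki 2017, §2.1, real normal form of a fold; the classical parametric Morse
lemma): with the critical curve `ξ` (`exists_critCurve_suspended`) and
`g(t, ξ t + u) = c(t) + u² Q(t, u)` (`exists_sq_mul_suspended`, `2Q(t₀,0) = ∂ₓ∂ₓg ≠ 0` by
`two_mul_eq_of_sq_mul`), put `ε = sign Q(t₀, 0)`, `v = u √(ε Q)`; then
`φ = (t - t₀, v(t, x - ξ t), A y + B z, B y + A z)` with `A = (1+ε)/2`, `B = (1-ε)/2`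
(the identity or the swap of the last two coordinates) and `ψ = (a - t₀, ε (b - c(a)))` are local
diffeomorphisms (inverse function theorem) with `ψ (F q) = (φ₀ q, (φ₁ q)² + (φ₂ q)² - (φ₃ q)²)`.
[cite: BaykurSaeki2017, §2.1] -/
theorem exists_foldChart_suspendedMap {g : ℝ × ℝ → ℝ} (hg : ContDiff ℝ ∞ g)
    {g' : ℝ × ℝ → ℝ × ℝ →L[ℝ] ℝ} (hg' : ∀ p, HasFDerivAt g (g' p) p) {x : 𝔼 4}
    {g'' : ℝ × ℝ →L[ℝ] ℝ} (hg'' : HasFDerivAt (fun p => g' p (0, 1)) g'' (x 0, x 1))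
    (hcrit : g' (x 0, x 1) (0, 1) = 0) (hfold : g'' (0, 1) ≠ 0) (hx2 : x 2 = 0)
    (hx3 : x 3 = 0) : HasIndefiniteFoldChart (suspendedMap g) x := by
  unfold HasIndefiniteFoldChart
  -- Steps A and B
  obtain ⟨U, hUo, ht₀U, ξ, hξ, hξ₀, hξcrit⟩ := exists_critCurve_suspended hg hg' hg'' hcrit hfold
  obtain ⟨Q, hQs, hQ⟩ := exists_sq_mul_suspended hg hg' hUo ht₀U hξ hξcrit
  have hQ0 : Q (x 0, 0) ≠ 0 := by
    have h := two_mul_eq_of_sq_mul hg' hg'' hQs fun u => by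
      have := hQ.self_of_nhds u
      rwa [hξ₀] at this
    intro h0
    apply hfold
    rw [← h, h0, mul_zero]
  -- the sign `ε` of `Q (t₀, 0)`
  obtain ⟨ε, hε2, hεpos⟩ : ∃ ε : ℝ, ε ^ 2 = 1 ∧ 0 < ε * Q (x 0, 0) := by
    rcases lt_or_gt_of_ne hQ0 with h | h
    · exact ⟨-1, by norm_num, by nlinarith⟩
    · exact ⟨1, by norm_num, by nlinarith⟩
  -- an open `V ∋ t₀` on which `ξ` is smooth and the division identity holds
  obtain ⟨V, hVsub, hVo, ht₀V⟩ : ∃ V ⊆ U ∩ {t | ∀ u, g (t, ξ t + u) - g (t, ξ t) =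
      u ^ 2 * Q (t, u)}, IsOpen V ∧ x 0 ∈ V :=
    _root_.mem_nhds_iff.1 (Filter.inter_mem (hUo.mem_nhds ht₀U) hQ)
  have hVU : V ⊆ U := fun t ht => (hVsub ht).1
  have hid : ∀ t ∈ V, ∀ u, g (t, ξ t + u) - g (t, ξ t) = u ^ 2 * Q (t, u) := fun t ht =>
    (hVsub ht).2
  have hξV : ContDiffOn ℝ ∞ ξ V := hξ.mono hVU
  -- `ρ = ε Q > 0` on the open `W ∋ (t₀, 0)`; `v = u √ρ`
  set ρ : ℝ × ℝ → ℝ := fun p => ε * Q p with hρ_def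
  have hρs : ContDiff ℝ ∞ ρ := contDiff_const.mul hQs
  set W : Set (ℝ × ℝ) := {p | 0 < ρ p} with hW_def
  have hWo : IsOpen W := isOpen_lt continuous_const hρs.continuous
  have hW₀ : ((x 0, (0 : ℝ)) : ℝ × ℝ) ∈ W := hεpos
  set v : ℝ × ℝ → ℝ := fun p => p.2 * Real.sqrt (ρ p) with hv_def
  have hvs : ContDiffOn ℝ ∞ v W :=
    contDiffOn_snd.mul (hρs.contDiffOn.sqrt fun p hp => ne_of_gt hp)
  -- derivative data at the base point
  have hξd : HasDerivAt ξ (deriv ξ (x 0)) (x 0) :=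
    ((hξV.contDiffAt (hVo.mem_nhds ht₀V)).differentiableAt (by simp)).hasDerivAt
  set c : ℝ → ℝ := fun t => g (t, ξ t) with hc_def
  have hcs : ContDiffOn ℝ ∞ c V := hg.comp_contDiffOn (contDiffOn_id.prodMk hξV)
  have hcd : HasDerivAt c (deriv c (x 0)) (x 0) :=
    ((hcs.contDiffAt (hVo.mem_nhds ht₀V)).differentiableAt (by simp)).hasDerivAt
  set r₀ : ℝ := Real.sqrt (ρ (x 0, 0)) with hr₀
  have hr₀pos : 0 < r₀ := Real.sqrt_pos.2 hεpos
  have hvd : HasFDerivAt v (r₀ • ContinuousLinearMap.snd ℝ ℝ ℝ) (x 0, 0) := by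
    have hr : HasFDerivAt (fun p => Real.sqrt (ρ p))
        (fderiv ℝ (fun p => Real.sqrt (ρ p)) (x 0, 0)) (x 0, 0) :=
      ((hρs.contDiffAt.sqrt (ne_of_gt hεpos)).differentiableAt (by simp)).hasFDerivAt
    have h := (hasFDerivAt_snd (𝕜 := ℝ) (E := ℝ) (F := ℝ) (p := ((x 0, (0 : ℝ)) : ℝ × ℝ))).mul hr
    refine h.congr_fderiv ?_
    simp [hr₀]
  -- the source chart `Φ`
  set A : ℝ := (1 + ε) / 2 with hA
  set B : ℝ := (1 - ε) / 2 with hB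
  have hAB : A ^ 2 - B ^ 2 = ε := by
    rw [hA, hB]
    ring
  set ι : 𝔼 4 → ℝ × ℝ := fun q => (q 0, q 1 - ξ (q 0)) with hι_def
  set Φ : 𝔼 4 → 𝔼 4 := fun q =>
    WithLp.toLp 2 ![q 0 - x 0, v (ι q), A * q 2 + B * q 3, B * q 2 + A * q 3] with hΦ_def
  set O₃ : Set (𝔼 4) := {q | q 0 ∈ V} ∩ ι ⁻¹' W with hO₃_def
  have hPc : ∀ i : Fin 4, ContDiff ℝ ∞ fun q : 𝔼 4 => q i := fun i =>
    (EuclideanSpace.proj i : 𝔼 4 →L[ℝ] ℝ).contDiff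
  have hV4o : IsOpen {q : 𝔼 4 | q 0 ∈ V} := hVo.preimage (hPc 0).continuous
  have hιs : ContDiffOn ℝ ∞ ι {q : 𝔼 4 | q 0 ∈ V} :=
    (hPc 0).contDiffOn.prodMk ((hPc 1).contDiffOn.sub (hξV.comp (hPc 0).contDiffOn fun q hq => hq))
  have hO₃o : IsOpen O₃ := hιs.continuousOn.isOpen_inter_preimage hV4o hWo
  have hxι : ι x = (x 0, 0) := by simp [hι_def, hξ₀]
  have hxO₃ : x ∈ O₃ := ⟨ht₀V, by show ι x ∈ W; rw [hxι]; exact hW₀⟩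
  have hΦs : ContDiffOn ℝ ∞ Φ O₃ := by
    rw [contDiffOn_euclidean]
    intro i
    fin_cases i
    · simpa [hΦ_def] using ((hPc 0).sub contDiff_const).contDiffOn (s := O₃)
    · have h : ContDiffOn ℝ ∞ (fun q => v (ι q)) O₃ :=
        hvs.comp (hιs.mono inter_subset_left) fun q hq => hq.2
      simpa [hΦ_def] using h
    · simpa [hΦ_def] using
        ((contDiff_const.mul (hPc 2)).add (contDiff_const.mul (hPc 3))).contDiffOn (s := O₃)
    · simpa [hΦ_def] using
        ((contDiff_const.mul (hPc 2)).add (contDiff_const.mul (hPc 3))).contDiffOn (s := O₃)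
  -- the derivative of `Φ` at `x`
  set P : Fin 4 → (𝔼 4 →L[ℝ] ℝ) := fun i => EuclideanSpace.proj i with hP_def
  have hPd : ∀ i, HasFDerivAt (fun q : 𝔼 4 => q i) (P i) x := fun i =>
    (EuclideanSpace.proj i : 𝔼 4 →L[ℝ] ℝ).hasFDerivAt
  set L₁ : 𝔼 4 →L[ℝ] ℝ := r₀ • (P 1 - deriv ξ (x 0) • P 0) with hL₁
  set Φ' : 𝔼 4 →L[ℝ] 𝔼 4 :=
    (P 0).smulRight (EuclideanSpace.single (0 : Fin 4) (1 : ℝ)) +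
      L₁.smulRight (EuclideanSpace.single (1 : Fin 4) (1 : ℝ)) +
      (A • P 2 + B • P 3).smulRight (EuclideanSpace.single (2 : Fin 4) (1 : ℝ)) +
      (B • P 2 + A • P 3).smulRight (EuclideanSpace.single (3 : Fin 4) (1 : ℝ)) with hΦ'
  have hιd : HasFDerivAt ι ((P 0).prod (P 1 - deriv ξ (x 0) • P 0)) x :=
    (hPd 0).prodMk ((hPd 1).sub (hξd.comp_hasFDerivAt x (hPd 0)))
  have hvd' : HasFDerivAt v (r₀ • ContinuousLinearMap.snd ℝ ℝ ℝ) (ι x) := by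
    rw [hxι]
    exact hvd
  have hVd : HasFDerivAt (fun q => v (ι q)) L₁ x := by
    refine (hvd'.comp x hιd).congr_fderiv ?_
    ext w
    simp [hL₁]
  have hΦd : HasFDerivAt Φ Φ' x := by
    rw [← hasFDerivWithinAt_univ]
    refine hasFDerivWithinAt_euclidean.2 fun i => ?_
    fin_cases i
    · refine (((hPd 0).sub_const (x 0)).hasFDerivWithinAt (s := univ)).congr_fderiv ?_
      ext w
      simp [hΦ', hP_def]
    · refine (hVd.hasFDerivWithinAt (s := univ)).congr_fderiv ?_
      ext w
      simp [hΦ', hP_def]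
    · refine (((((hPd 2).const_mul A).add ((hPd 3).const_mul B))).hasFDerivWithinAt
        (s := univ)).congr_fderiv ?_
      ext w
      simp [hΦ', hP_def]
    · refine (((((hPd 2).const_mul B).add ((hPd 3).const_mul A))).hasFDerivWithinAt
        (s := univ)).congr_fderiv ?_
      ext w
      simp [hΦ', hP_def]
  -- `Φ'` is injective (triangular with non-zero diagonal), hence an isomorphism
  have hε0 : ε ≠ 0 := by
    rintro rfl
    norm_num at hε2
  have hΦ'inj : Injective Φ' := by
    refine (injective_iff_map_eq_zero Φ').2 fun w hw => ?_
    have h0 : Φ' w 0 = 0 := by rw [hw]; rfl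
    have h1 : Φ' w 1 = 0 := by rw [hw]; rfl
    have h2 : Φ' w 2 = 0 := by rw [hw]; rfl
    have h3 : Φ' w 3 = 0 := by rw [hw]; rfl
    simp [hΦ', hP_def, hL₁] at h0 h1 h2 h3
    have hw1 : w 1 = 0 := by
      rcases h1 with h1 | h1
      · exact absurd h1 hr₀pos.ne'
      · rw [h0, mul_zero, sub_zero] at h1
        exact h1
    have hw2 : w 2 = 0 := by
      have : ε * w 2 = 0 := by
        rw [← hAB]
        linear_combination A * h2 - B * h3
      exact (mul_eq_zero.mp this).resolve_left hε0
    have hw3 : w 3 = 0 := by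
      have : ε * w 3 = 0 := by
        rw [← hAB]
        linear_combination A * h3 - B * h2
      exact (mul_eq_zero.mp this).resolve_left hε0
    ext i
    fin_cases i
    · simpa using h0
    · simpa using hw1
    · simpa using hw2
    · simpa using hw3
  obtain ⟨T₃, hT₃⟩ := exists_continuousLinearEquiv_coe_eq hΦ'inj
  obtain ⟨G₃, hG₃Φ, hxG₃, hG₃O, hG₃s, hG₃s'⟩ :=
    exists_openPartialHomeomorph_contDiffOn_symm hO₃o hxO₃ (m := ∞) (by simp) hΦs T₃
      (by rw [hT₃]; exact hΦd)
  -- the target chart `Ψ`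
  set y₀ : 𝔼 2 := suspendedMap g x with hy₀
  have hy₀0 : y₀ 0 = x 0 := suspendedMap_apply_zero g x
  set Ψ : 𝔼 2 → 𝔼 2 := fun w => WithLp.toLp 2 ![w 0 - x 0, ε * (w 1 - c (w 0))] with hΨ_def
  set O₄ : Set (𝔼 2) := {w | w 0 ∈ V} with hO₄_def
  have hP₂c : ∀ i : Fin 2, ContDiff ℝ ∞ fun w : 𝔼 2 => w i := fun i =>
    (EuclideanSpace.proj i : 𝔼 2 →L[ℝ] ℝ).contDiff
  have hO₄o : IsOpen O₄ := hVo.preimage (hP₂c 0).continuous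
  have hy₀O₄ : y₀ ∈ O₄ := by
    show y₀ 0 ∈ V
    rw [hy₀0]
    exact ht₀V
  have hΨs : ContDiffOn ℝ ∞ Ψ O₄ := by
    rw [contDiffOn_euclidean]
    intro i
    fin_cases i
    · simpa [hΨ_def] using ((hP₂c 0).sub contDiff_const).contDiffOn (s := O₄)
    · have h : ContDiffOn ℝ ∞ (fun w : 𝔼 2 => ε * (w 1 - c (w 0))) O₄ :=
        contDiffOn_const.mul
          ((hP₂c 1).contDiffOn.sub (hcs.comp (hP₂c 0).contDiffOn fun w hw => hw))
      simpa [hΨ_def] using h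
  set P₂ : Fin 2 → (𝔼 2 →L[ℝ] ℝ) := fun i => EuclideanSpace.proj i with hP₂_def
  have hP₂d : ∀ i, HasFDerivAt (fun w : 𝔼 2 => w i) (P₂ i) y₀ := fun i =>
    (EuclideanSpace.proj i : 𝔼 2 →L[ℝ] ℝ).hasFDerivAt
  set M₁ : 𝔼 2 →L[ℝ] ℝ := ε • (P₂ 1 - deriv c (x 0) • P₂ 0) with hM₁
  set Ψ' : 𝔼 2 →L[ℝ] 𝔼 2 :=
    (P₂ 0).smulRight (EuclideanSpace.single (0 : Fin 2) (1 : ℝ)) +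
      M₁.smulRight (EuclideanSpace.single (1 : Fin 2) (1 : ℝ)) with hΨ'
  have hcd' : HasDerivAt c (deriv c (x 0)) (y₀ 0) := by
    rw [hy₀0]
    exact hcd
  have hΨd : HasFDerivAt Ψ Ψ' y₀ := by
    rw [← hasFDerivWithinAt_univ]
    refine hasFDerivWithinAt_euclidean.2 fun i => ?_
    fin_cases i
    · refine (((hP₂d 0).sub_const (x 0)).hasFDerivWithinAt (s := univ)).congr_fderiv ?_
      ext w
      simp [hΨ', hP₂_def]
    · have h := (((hP₂d 1).sub (hcd'.comp_hasFDerivAt y₀ (hP₂d 0))).const_mul ε).hasFDerivWithinAt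
        (s := univ)
      refine h.congr_fderiv ?_
      ext w
      simp [hΨ', hP₂_def, hM₁]
  have hΨ'inj : Injective Ψ' := by
    refine (injective_iff_map_eq_zero Ψ').2 fun w hw => ?_
    have h0 : Ψ' w 0 = 0 := by rw [hw]; rfl
    have h1 : Ψ' w 1 = 0 := by rw [hw]; rfl
    simp [hΨ', hP₂_def, hM₁] at h0 h1
    have hw1 : w 1 = 0 := by
      rcases h1 with h1 | h1
      · exact absurd h1 hε0
      · rw [h0, mul_zero, sub_zero] at h1
        exact h1
    ext i
    fin_cases i
    · simpa using h0
    · simpa using hw1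
  obtain ⟨T₄, hT₄⟩ := exists_continuousLinearEquiv_coe_eq hΨ'inj
  obtain ⟨G₄, hG₄Ψ, hyG₄, hG₄O, hG₄s, hG₄s'⟩ :=
    exists_openPartialHomeomorph_contDiffOn_symm hO₄o hy₀O₄ (m := ∞) (by simp) hΨs T₄
      (by rw [hT₄]; exact hΨd)
  -- assembly
  have hFc : Continuous (suspendedMap g) := (contDiff_suspendedMap hg).continuous
  set S : Set (𝔼 4) := suspendedMap g ⁻¹' G₄.source with hS
  have hSo : IsOpen S := G₄.open_source.preimage hFc
  have hsrc : (G₃.restrOpen S hSo).source = G₃.source ∩ S :=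
    OpenPartialHomeomorph.restrOpen_source G₃ S hSo
  have htgt : (G₃.restrOpen S hSo).target ⊆ G₃.target := by
    intro z hz
    have h1 : (G₃.restrOpen S hSo).symm z ∈ (G₃.restrOpen S hSo).source :=
      (G₃.restrOpen S hSo).map_target hz
    have h2 : (G₃.restrOpen S hSo) ((G₃.restrOpen S hSo).symm z) = z :=
      (G₃.restrOpen S hSo).right_inv hz
    rw [hsrc] at h1
    have h3 : G₃ (G₃.symm z) = z := h2
    rw [← h3]
    exact G₃.map_source h1.1
  refine ⟨G₃.restrOpen S hSo, G₄, ?_, ?_, ?_, ?_, ?_, hG₄s, hG₄s', ?_⟩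
  · rw [hsrc]
    exact ⟨hxG₃, hyG₄⟩
  · show G₃ x = 0
    rw [hG₃Φ]
    ext i
    fin_cases i <;> simp [hΦ_def, hxι, hv_def, hx2, hx3]
  · intro q hq
    rw [hsrc] at hq
    exact hq.2
  · rw [hsrc]
    exact hG₃s.mono inter_subset_left
  · exact hG₃s'.mono htgt
  · intro q hq
    rw [hsrc] at hq
    have hqO : q ∈ O₃ := hG₃O hq.1
    have hq0 : q 0 ∈ V := hqO.1
    have hqW : 0 < ρ (ι q) := hqO.2
    have eφ : (G₃.restrOpen S hSo) q = Φ q := by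
      rw [← hG₃Φ]
      rfl
    rw [eφ, hG₄Ψ]
    have hdiv := hid (q 0) hq0 (q 1 - ξ (q 0))
    rw [add_sub_cancel] at hdiv
    have hsq : Real.sqrt (ρ (ι q)) ^ 2 = ρ (ι q) := Real.sq_sqrt hqW.le
    simp only [hρ_def, hι_def] at hsq
    constructor
    · simp [hΨ_def, hΦ_def]
    · simp [hΨ_def, hΦ_def, hv_def, hι_def, hρ_def, hc_def]
      linear_combination ε * hdiv - (q 1 - ξ (q 0)) ^ 2 * hsq - (q 2 ^ 2 - q 3 ^ 2) * hAB

/-- **Every critical point of a suspended family with `∂ₓ∂ₓ g ≠ 0` is an indefinite fold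
point** — `exists_foldChart_suspendedMap` with the derivatives expressed through `fderiv`.
[cite: BaykurSaeki2017, §2.1] -/
theorem hasIndefiniteFoldChart_suspendedMap {g : ℝ × ℝ → ℝ} (hg : ContDiff ℝ ∞ g) {x : 𝔼 4}
    (hcrit : fderiv ℝ g (x 0, x 1) (0, 1) = 0)
    (hfold : fderiv ℝ (fun p => fderiv ℝ g p (0, 1)) (x 0, x 1) (0, 1) ≠ 0)
    (hx2 : x 2 = 0) (hx3 : x 3 = 0) : HasIndefiniteFoldChart (suspendedMap g) x := by
  have hg' : ∀ p, HasFDerivAt g (fderiv ℝ g p) p := fun p =>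
    (hg.differentiable (by simp) p).hasFDerivAt
  have hgx : ContDiff ℝ ∞ fun p => fderiv ℝ g p (0, 1) :=
    (hg.fderiv_right le_rfl).clm_apply contDiff_const
  have hg'' : HasFDerivAt (fun p => fderiv ℝ g p (0, 1))
      (fderiv ℝ (fun p => fderiv ℝ g p (0, 1)) (x 0, x 1)) (x 0, x 1) :=
    (hgx.differentiable (by simp) _).hasFDerivAt
  exact exists_foldChart_suspendedMap hg hg' hg'' hcrit hfold hx2 hx3

/-! ### The models of the move calculus: fold points away from the cusps -/

/-- **"An indefinite cusp is always adjacent to indefinite fold arcs"** (Baykur–Saeki 2017,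
§2.1, p. 6): every critical point of the cusp model `(t, x³ + t x + y² - z²)` other than the
cusp point `0` itself is an indefinite fold point (`∂ₓ∂ₓ g = 6x ≠ 0` there).
[cite: BaykurSaeki2017, §2.1] -/
theorem hasIndefiniteFoldChart_indefiniteCuspMap {x : 𝔼 4}
    (hx : ¬ Surjective (fderiv ℝ indefiniteCuspMap x)) (hx0 : x ≠ 0) :
    HasIndefiniteFoldChart indefiniteCuspMap x := by
  rw [surjective_fderiv_indefiniteCuspMap_iff, not_not] at hx
  obtain ⟨h1, h2, h3⟩ := hx
  have hx1 : x 1 ≠ 0 := by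
    intro h
    apply hx0
    ext i
    fin_cases i
    · simp only [h] at h1
      simpa using h1
    · simpa using h
    · simpa using h2
    · simpa using h3
  have e1 : ∀ p : ℝ × ℝ, fderiv ℝ (fun p : ℝ × ℝ => p.2 ^ 3 + p.1 * p.2) p (0, 1) =
      3 * p.2 ^ 2 + p.1 := fun p => by
    obtain ⟨g', hg, hval⟩ : ∃ g' : ℝ × ℝ →L[ℝ] ℝ,
        HasFDerivAt (fun p : ℝ × ℝ => p.2 ^ 3 + p.1 * p.2) g' p ∧ g' (0, 1) = 3 * p.2 ^ 2 + p.1 :=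
      ⟨_, (hasFDerivAt_snd.pow 3).add (hasFDerivAt_fst.mul hasFDerivAt_snd), by simp⟩
    rw [hg.fderiv, hval]
  unfold indefiniteCuspMap
  refine hasIndefiniteFoldChart_suspendedMap
    ((contDiff_snd.pow 3).add (contDiff_fst.mul contDiff_snd)) ?_ ?_ h2 h3
  · rw [e1]
    exact h1
  · rw [show (fun p : ℝ × ℝ => fderiv ℝ (fun p : ℝ × ℝ => p.2 ^ 3 + p.1 * p.2) p (0, 1)) =
        fun p => 3 * p.2 ^ 2 + p.1 from funext e1]
    obtain ⟨g'', hg2, hval2⟩ : ∃ g'' : ℝ × ℝ →L[ℝ] ℝ,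
        HasFDerivAt (fun p : ℝ × ℝ => 3 * p.2 ^ 2 + p.1) g'' (x 0, x 1) ∧
          g'' (0, 1) = 3 * (2 * x 1) :=
      ⟨_, ((hasFDerivAt_snd.pow 2).const_mul 3).add hasFDerivAt_fst, by simp⟩
    rw [hg2.fderiv, hval2]
    intro h
    exact hx1 (by linarith)

/-- **The critical points of Lekili's birth family with `x ≠ 0` are indefinite fold points**
(`g = x³ + 3(t² - s)x`, `∂ₓ∂ₓ g = 6x`); for `s > 0` the two excluded points `x = 0` of the
critical circle are the cusps (`BirthMoveCriticalImage.lean`). [cite: Lekili2009, §3 Move 1] -/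
theorem hasIndefiniteFoldChart_birthMap {s : ℝ} {x : 𝔼 4}
    (hx : ¬ Surjective (fderiv ℝ (birthMap s) x)) (hx1 : x 1 ≠ 0) :
    HasIndefiniteFoldChart (birthMap s) x := by
  rw [surjective_fderiv_birthMap_iff, not_not] at hx
  obtain ⟨h1, h2, h3⟩ := hx
  have e1 : ∀ p : ℝ × ℝ, fderiv ℝ (fun p : ℝ × ℝ => p.2 ^ 3 + 3 * (p.1 ^ 2 - s) * p.2) p (0, 1) =
      3 * p.2 ^ 2 + 3 * (p.1 ^ 2 - s) := fun p => by
    obtain ⟨g', hg, hval⟩ : ∃ g' : ℝ × ℝ →L[ℝ] ℝ,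
        HasFDerivAt (fun p : ℝ × ℝ => p.2 ^ 3 + 3 * (p.1 ^ 2 - s) * p.2) g' p ∧
          g' (0, 1) = 3 * p.2 ^ 2 + 3 * (p.1 ^ 2 - s) :=
      ⟨_, (hasFDerivAt_snd.pow 3).add
        ((((hasFDerivAt_fst.pow 2).sub_const s).const_mul 3).mul hasFDerivAt_snd), by simp⟩
    rw [hg.fderiv, hval]
  unfold birthMap
  refine hasIndefiniteFoldChart_suspendedMap ((contDiff_snd.pow 3).add
    ((contDiff_const.mul ((contDiff_fst.pow 2).sub contDiff_const)).mul contDiff_snd)) ?_ ?_ h2 h3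
  · rw [e1]
    nlinarith [h1]
  · rw [show (fun p : ℝ × ℝ => fderiv ℝ (fun p : ℝ × ℝ => p.2 ^ 3 + 3 * (p.1 ^ 2 - s) * p.2) p
        (0, 1)) = fun p => 3 * p.2 ^ 2 + 3 * (p.1 ^ 2 - s) from funext e1]
    obtain ⟨g'', hg2, hval2⟩ : ∃ g'' : ℝ × ℝ →L[ℝ] ℝ,
        HasFDerivAt (fun p : ℝ × ℝ => 3 * p.2 ^ 2 + 3 * (p.1 ^ 2 - s)) g'' (x 0, x 1) ∧
          g'' (0, 1) = 3 * (2 * x 1) :=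
      ⟨_, ((hasFDerivAt_snd.pow 2).const_mul 3).add
        (((hasFDerivAt_fst.pow 2).sub_const s).const_mul 3), by simp⟩
    rw [hg2.fderiv, hval2]
    intro h
    exact hx1 (by linarith)

/-- **The critical points of Lekili's merging family with `x ≠ 0` are indefinite fold points**
(`g = x³ + 3(s - t²)x`, `∂ₓ∂ₓ g = 6x`); for `s > 0` the excluded points are the two cusps, one
on each branch (`MergingMoveCriticalImage.lean`). [cite: Lekili2009, §3 Move 2] -/
theorem hasIndefiniteFoldChart_mergeMap {s : ℝ} {x : 𝔼 4}
    (hx : ¬ Surjective (fderiv ℝ (mergeMap s) x)) (hx1 : x 1 ≠ 0) :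
    HasIndefiniteFoldChart (mergeMap s) x := by
  rw [surjective_fderiv_mergeMap_iff, not_not] at hx
  obtain ⟨h1, h2, h3⟩ := hx
  have e1 : ∀ p : ℝ × ℝ, fderiv ℝ (fun p : ℝ × ℝ => p.2 ^ 3 + 3 * (s - p.1 ^ 2) * p.2) p (0, 1) =
      3 * p.2 ^ 2 + 3 * (s - p.1 ^ 2) := fun p => by
    obtain ⟨g', hg, hval⟩ : ∃ g' : ℝ × ℝ →L[ℝ] ℝ,
        HasFDerivAt (fun p : ℝ × ℝ => p.2 ^ 3 + 3 * (s - p.1 ^ 2) * p.2) g' p ∧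
          g' (0, 1) = 3 * p.2 ^ 2 + 3 * (s - p.1 ^ 2) :=
      ⟨_, (hasFDerivAt_snd.pow 3).add
        ((((hasFDerivAt_fst.pow 2).const_sub s).const_mul 3).mul hasFDerivAt_snd), by simp⟩
    rw [hg.fderiv, hval]
  unfold mergeMap
  refine hasIndefiniteFoldChart_suspendedMap ((contDiff_snd.pow 3).add
    ((contDiff_const.mul (contDiff_const.sub (contDiff_fst.pow 2))).mul contDiff_snd)) ?_ ?_ h2 h3
  · rw [e1]
    nlinarith [h1]
  · rw [show (fun p : ℝ × ℝ => fderiv ℝ (fun p : ℝ × ℝ => p.2 ^ 3 + 3 * (s - p.1 ^ 2) * p.2) p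
        (0, 1)) = fun p => 3 * p.2 ^ 2 + 3 * (s - p.1 ^ 2) from funext e1]
    obtain ⟨g'', hg2, hval2⟩ : ∃ g'' : ℝ × ℝ →L[ℝ] ℝ,
        HasFDerivAt (fun p : ℝ × ℝ => 3 * p.2 ^ 2 + 3 * (s - p.1 ^ 2)) g'' (x 0, x 1) ∧
          g'' (0, 1) = 3 * (2 * x 1) :=
      ⟨_, ((hasFDerivAt_snd.pow 2).const_mul 3).add
        (((hasFDerivAt_fst.pow 2).const_sub s).const_mul 3), by simp⟩
    rw [hg2.fderiv, hval2]
    intro h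
    exact hx1 (by linarith)

/-- **The critical points of Lekili's flipping family with `6x² ≠ s` are indefinite fold
points** (`g = x⁴ - s x² + t x`, `∂ₓ∂ₓ g = 12x² - 2s`); the excluded parameters `6u² = s` are
exactly the cusps of the flipped base diagram (`SuspendedFamilyCriticalImage.lean`: none for
`s < 0`, two for `s > 0`). [cite: Lekili2009, §3 Move 3] -/
theorem hasIndefiniteFoldChart_flipMap {s : ℝ} {x : 𝔼 4}
    (hx : ¬ Surjective (fderiv ℝ (flipMap s) x)) (hxs : 6 * x 1 ^ 2 ≠ s) :
    HasIndefiniteFoldChart (flipMap s) x := by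
  rw [surjective_fderiv_flipMap_iff, not_not] at hx
  obtain ⟨h1, h2, h3⟩ := hx
  have e1 : ∀ p : ℝ × ℝ, fderiv ℝ (fun p : ℝ × ℝ => p.2 ^ 4 - s * p.2 ^ 2 + p.1 * p.2) p (0, 1) =
      4 * p.2 ^ 3 - s * (2 * p.2) + p.1 := fun p => by
    obtain ⟨g', hg, hval⟩ : ∃ g' : ℝ × ℝ →L[ℝ] ℝ,
        HasFDerivAt (fun p : ℝ × ℝ => p.2 ^ 4 - s * p.2 ^ 2 + p.1 * p.2) g' p ∧
          g' (0, 1) = 4 * p.2 ^ 3 - s * (2 * p.2) + p.1 :=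
      ⟨_, ((hasFDerivAt_snd.pow 4).sub ((hasFDerivAt_snd.pow 2).const_mul s)).add
        (hasFDerivAt_fst.mul hasFDerivAt_snd), by simp⟩
    rw [hg.fderiv, hval]
  unfold flipMap
  refine hasIndefiniteFoldChart_suspendedMap (((contDiff_snd.pow 4).sub
    (contDiff_const.mul (contDiff_snd.pow 2))).add (contDiff_fst.mul contDiff_snd)) ?_ ?_ h2 h3
  · rw [e1]
    linarith [h1]
  · rw [show (fun p : ℝ × ℝ => fderiv ℝ (fun p : ℝ × ℝ => p.2 ^ 4 - s * p.2 ^ 2 + p.1 * p.2) p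
        (0, 1)) = fun p => 4 * p.2 ^ 3 - s * (2 * p.2) + p.1 from funext e1]
    obtain ⟨g'', hg2, hval2⟩ : ∃ g'' : ℝ × ℝ →L[ℝ] ℝ,
        HasFDerivAt (fun p : ℝ × ℝ => 4 * p.2 ^ 3 - s * (2 * p.2) + p.1) g'' (x 0, x 1) ∧
          g'' (0, 1) = 4 * (3 * x 1 ^ 2) - s * 2 :=
      ⟨_, (((hasFDerivAt_snd.pow 3).const_mul 4).sub
        ((hasFDerivAt_snd.const_mul 2).const_mul s)).add hasFDerivAt_fst, by simp⟩
    rw [hg2.fderiv, hval2]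
    intro h
    exact hxs (by linarith)

end Literature.Topology.FourManifolds

end
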